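import Summits.CriticalPhenomena.SAWScalingLimit.Theorems.SAWReversalUpgradeAttachReversalReversalBDeg

/-!
# Attachment reversal: exact time reversal, part C (cut times, traces, and the main symmetry)

Helper file for item `AttachReversal` of route `SAWReversalUpgrade` (stmt-CriticalPhenomena-18007).
Setting of parts A–B. We conclude the exact-reversal symmetry of the route's attachment data:

* `rev_uMid`, `rev_vMid` — `uMid' = 1 - vMid`, `vMid' = 1 - uMid` (trimmed interval nonempty);
* `rev_access`, `rev_exit` — the primed access segment is the unprimed exit ray and conversely;
* `rev_attSet` — the prescribed traces coincide, `S₁' = S₁`;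
* `uMid_vMid_of_lt` — an empty trimmed interval gives `uMid = vMid = 0` (fallback on both sides);
* `rev_fallback` — the fallback traces coincide;
* `rev_main` — `(uMid' < vMid' ↔ uMid < vMid)`, `S₁' = S₁` when `uMid < vMid`, and
  `fallback' = fallback`: the data the two `let`-blocks of `AttachReversal` prescribe for the ranges
  of `c'` and `c` are the same.
-/

noncomputable section

open Set Function Filter Topology Complex
open UpperHalfPlane (upperHalfPlaneSet)
open Literature.Probability.RandomPlanarGeometry

namespace Summit.CriticalPhenomena.SAWScalingLimit.Theorems.AttachReversal

variable {D : DobrushinDomain} {φ : ConformalEquiv upperHalfPlaneSet D.carrier}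
  {φ' : ConformalEquiv upperHalfPlaneSet D.swap.carrier} {c e : ℝ} {U : ℝ → ℂ}

/-- The reflection `t ↦ 1 - t` is antitone. -/
theorem antitone_one_sub : Antitone fun t : ℝ => 1 - t := fun _ _ h => by linarith

/-! ### The cut times -/

/-- **`uMid' = 1 - vMid`** (trimmed interval nonempty). -/
theorem rev_uMid (hφ : D.IsChordalUniformizing φ) (hφ' : D.swap.IsChordalUniformizing φ')
    (hc : 0 < c) (heq : ∀ z ∈ upperHalfPlaneSet, φ' z = φ (-((c : ℂ) * z)⁻¹)) (he : 0 < e)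
    (he' : e ≤ 1 / 2) (hU : Continuous U) (hcl : ∀ s, U s ∈ closure D.carrier) (h1a : U 1 ≠ D.pt 0)
    (hij : lastA (D.pt 0) U ≤ firstB (D.pt 1) U) :
    uMid (D.pt 1) (D.pt 0) φ'.boundaryExtension e (fun u => U (1 - u)) =
      1 - vMid (D.pt 0) (D.pt 1) φ.boundaryExtension e U := by
  by_cases hjb : U (firstB (D.pt 1) U) = D.pt 1
  · obtain ⟨-, -, hu', hv⟩ := rev_of_lastB hφ hφ' hc heq he he' hcl hij hjb
    rw [hu', hv]
  obtain ⟨-, -, hX'⟩ := rev_sAcc_of_ne hφ hφ' hc heq he he' hU hcl h1a hij hjb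
  obtain ⟨-, hrM, -, -⟩ := exit_spec hφ he he' hU hcl h1a hij hjb
  have hZ : ∀ u, attZ (D.pt 0) φ'.boundaryExtension e (fun u => U (1 - u)) u =
      attZ (D.pt 1) φ.boundaryExtension e U (1 - u) := rev_attZ hφ hφ' hc heq he he' hcl
  show sInf {u : ℝ | u ∈ Icc (lastA (D.pt 1) fun u => U (1 - u)) (firstB (D.pt 0) fun u => U (1 - u)) ∧
      attZ (D.pt 0) φ'.boundaryExtension e (fun u => U (1 - u)) u =
        φ'.boundaryExtension ((sAcc (D.pt 1) (D.pt 0) φ'.boundaryExtension e (fun u => U (1 - u)) : ℂ) *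
          pAcc (D.pt 1) φ'.boundaryExtension e (fun u => U (1 - u)))} =
    1 - vMid (D.pt 0) (D.pt 1) φ.boundaryExtension e U
  rw [hX']
  have hT : {u : ℝ | u ∈ Icc (lastA (D.pt 1) fun u => U (1 - u)) (firstB (D.pt 0) fun u => U (1 - u)) ∧
      attZ (D.pt 0) φ'.boundaryExtension e (fun u => U (1 - u)) u =
        φ.boundaryExtension ((rEx (D.pt 0) (D.pt 1) φ.boundaryExtension e U : ℂ) *
          qEx (D.pt 1) φ.boundaryExtension e U)} =
      (fun t : ℝ => 1 - t) '' {t : ℝ | t ∈ Icc (lastA (D.pt 0) U) (firstB (D.pt 1) U) ∧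
        attZ (D.pt 1) φ.boundaryExtension e U t =
          φ.boundaryExtension ((rEx (D.pt 0) (D.pt 1) φ.boundaryExtension e U : ℂ) *
            qEx (D.pt 1) φ.boundaryExtension e U)} := by
    ext u
    simp only [mem_image, mem_setOf_eq, hZ u, mem_Icc_rev_iff]
    constructor
    · rintro ⟨hu, hY⟩; exact ⟨1 - u, ⟨hu, hY⟩, sub_sub_cancel 1 u⟩
    · rintro ⟨t, ⟨ht, hY⟩, rfl⟩; rw [sub_sub_cancel]; exact ⟨ht, hY⟩
  rw [hT]
  have hne : {t : ℝ | t ∈ Icc (lastA (D.pt 0) U) (firstB (D.pt 1) U) ∧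
      attZ (D.pt 1) φ.boundaryExtension e U t =
        φ.boundaryExtension ((rEx (D.pt 0) (D.pt 1) φ.boundaryExtension e U : ℂ) *
          qEx (D.pt 1) φ.boundaryExtension e U)}.Nonempty := by
    obtain ⟨t, ht, htY⟩ := hrM
    exact ⟨t, ht, htY⟩
  have hbdd : BddAbove {t : ℝ | t ∈ Icc (lastA (D.pt 0) U) (firstB (D.pt 1) U) ∧
      attZ (D.pt 1) φ.boundaryExtension e U t =
        φ.boundaryExtension ((rEx (D.pt 0) (D.pt 1) φ.boundaryExtension e U : ℂ) *
          qEx (D.pt 1) φ.boundaryExtension e U)} := ⟨firstB (D.pt 1) U, fun t ht => ht.1.2⟩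
  have h := antitone_one_sub.map_csSup_of_continuousAt (continuous_sub_left (1:ℝ)).continuousAt hne hbdd
  rw [← h]
  congr 1
  have h1 : {u : ℝ | u ∈ Icc (lastA (D.pt 0) U) (firstB (D.pt 1) U) ∧ U (firstB (D.pt 1) U) = D.pt 1 ∧
      u = firstB (D.pt 1) U} = ∅ := by
    ext u; simp only [mem_setOf_eq, mem_empty_iff_false, iff_false, not_and]
    exact fun _ h _ => hjb h
  have h2 : {u : ℝ | u ∈ Icc (lastA (D.pt 0) U) (firstB (D.pt 1) U) ∧ U (firstB (D.pt 1) U) ≠ D.pt 1 ∧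
      attZ (D.pt 1) φ.boundaryExtension e U u =
        φ.boundaryExtension ((rEx (D.pt 0) (D.pt 1) φ.boundaryExtension e U : ℂ) *
          qEx (D.pt 1) φ.boundaryExtension e U)} =
      {t : ℝ | t ∈ Icc (lastA (D.pt 0) U) (firstB (D.pt 1) U) ∧
        attZ (D.pt 1) φ.boundaryExtension e U t =
          φ.boundaryExtension ((rEx (D.pt 0) (D.pt 1) φ.boundaryExtension e U : ℂ) *
            qEx (D.pt 1) φ.boundaryExtension e U)} := by
    ext u; simp only [mem_setOf_eq]
    exact ⟨fun h => ⟨h.1, h.2.2⟩, fun h => ⟨h.1, hjb, h.2⟩⟩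
  unfold vMid
  rw [h1, h2, empty_union]

/-- **`vMid' = 1 - uMid`** (trimmed interval nonempty). -/
theorem rev_vMid (hφ : D.IsChordalUniformizing φ) (hφ' : D.swap.IsChordalUniformizing φ')
    (hc : 0 < c) (heq : ∀ z ∈ upperHalfPlaneSet, φ' z = φ (-((c : ℂ) * z)⁻¹)) (he : 0 < e)
    (he' : e ≤ 1 / 2) (hU : Continuous U) (hcl : ∀ s, U s ∈ closure D.carrier) (h0b : U 0 ≠ D.pt 1)
    (hij : lastA (D.pt 0) U ≤ firstB (D.pt 1) U) :
    vMid (D.pt 1) (D.pt 0) φ'.boundaryExtension e (fun u => U (1 - u)) =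
      1 - uMid (D.pt 0) (D.pt 1) φ.boundaryExtension e U := by
  by_cases hia : U (lastA (D.pt 0) U) = D.pt 0
  · obtain ⟨-, -, hu, hv'⟩ := rev_of_firstA hφ φ' he he' hcl hij hia
    rw [hv', hu]
  obtain ⟨-, -, hY'⟩ := rev_rEx_of_ne hφ hφ' hc heq he he' hU hcl h0b hij hia
  obtain ⟨-, hsM, -, -⟩ := access_spec hφ he he' hU hcl h0b hij hia
  have hZ : ∀ u, attZ (D.pt 0) φ'.boundaryExtension e (fun u => U (1 - u)) u =
      attZ (D.pt 1) φ.boundaryExtension e U (1 - u) := rev_attZ hφ hφ' hc heq he he' hcl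
  have hguard : U (1 - firstB (D.pt 0) fun u => U (1 - u)) ≠ D.pt 0 := by
    show (fun u => U (1 - u)) (firstB (D.pt 0) fun u => U (1 - u)) ≠ D.pt 0
    rw [rev_guard]; exact hia
  show sSup ({u : ℝ | u ∈ Icc (lastA (D.pt 1) fun u => U (1 - u)) (firstB (D.pt 0) fun u => U (1 - u)) ∧
        (fun u => U (1 - u)) (firstB (D.pt 0) fun u => U (1 - u)) = D.pt 0 ∧
        u = firstB (D.pt 0) fun u => U (1 - u)} ∪
      {u : ℝ | u ∈ Icc (lastA (D.pt 1) fun u => U (1 - u)) (firstB (D.pt 0) fun u => U (1 - u)) ∧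
        (fun u => U (1 - u)) (firstB (D.pt 0) fun u => U (1 - u)) ≠ D.pt 0 ∧
        attZ (D.pt 0) φ'.boundaryExtension e (fun u => U (1 - u)) u =
          φ'.boundaryExtension ((rEx (D.pt 1) (D.pt 0) φ'.boundaryExtension e (fun u => U (1 - u)) : ℂ) *
            qEx (D.pt 0) φ'.boundaryExtension e (fun u => U (1 - u)))}) =
    1 - uMid (D.pt 0) (D.pt 1) φ.boundaryExtension e U
  rw [hY']
  have h1 : {u : ℝ | u ∈ Icc (lastA (D.pt 1) fun u => U (1 - u)) (firstB (D.pt 0) fun u => U (1 - u)) ∧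
      (fun u => U (1 - u)) (firstB (D.pt 0) fun u => U (1 - u)) = D.pt 0 ∧
      u = firstB (D.pt 0) fun u => U (1 - u)} = ∅ := by
    ext u; simp only [mem_setOf_eq, mem_empty_iff_false, iff_false, not_and]
    exact fun _ h _ => hguard h
  have h2 : {u : ℝ | u ∈ Icc (lastA (D.pt 1) fun u => U (1 - u)) (firstB (D.pt 0) fun u => U (1 - u)) ∧
      (fun u => U (1 - u)) (firstB (D.pt 0) fun u => U (1 - u)) ≠ D.pt 0 ∧
      attZ (D.pt 0) φ'.boundaryExtension e (fun u => U (1 - u)) u =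
        φ.boundaryExtension ((sAcc (D.pt 0) (D.pt 1) φ.boundaryExtension e U : ℂ) *
          pAcc (D.pt 0) φ.boundaryExtension e U)} =
      (fun t : ℝ => 1 - t) '' {t : ℝ | t ∈ Icc (lastA (D.pt 0) U) (firstB (D.pt 1) U) ∧
        attZ (D.pt 1) φ.boundaryExtension e U t =
          φ.boundaryExtension ((sAcc (D.pt 0) (D.pt 1) φ.boundaryExtension e U : ℂ) *
            pAcc (D.pt 0) φ.boundaryExtension e U)} := by
    ext u
    simp only [mem_image, mem_setOf_eq, hZ u, mem_Icc_rev_iff]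
    constructor
    · rintro ⟨hu, -, hX⟩; exact ⟨1 - u, ⟨hu, hX⟩, sub_sub_cancel 1 u⟩
    · rintro ⟨t, ⟨ht, hX⟩, rfl⟩; rw [sub_sub_cancel]; exact ⟨ht, hguard, hX⟩
  rw [h1, h2, empty_union]
  have hne : {t : ℝ | t ∈ Icc (lastA (D.pt 0) U) (firstB (D.pt 1) U) ∧
      attZ (D.pt 1) φ.boundaryExtension e U t =
        φ.boundaryExtension ((sAcc (D.pt 0) (D.pt 1) φ.boundaryExtension e U : ℂ) *
          pAcc (D.pt 0) φ.boundaryExtension e U)}.Nonempty := by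
    obtain ⟨t, ht, htX⟩ := hsM
    exact ⟨t, ht, htX⟩
  have hbdd : BddBelow {t : ℝ | t ∈ Icc (lastA (D.pt 0) U) (firstB (D.pt 1) U) ∧
      attZ (D.pt 1) φ.boundaryExtension e U t =
        φ.boundaryExtension ((sAcc (D.pt 0) (D.pt 1) φ.boundaryExtension e U : ℂ) *
          pAcc (D.pt 0) φ.boundaryExtension e U)} := ⟨lastA (D.pt 0) U, fun t ht => ht.1.1⟩
  have h := antitone_one_sub.map_csInf_of_continuousAt (continuous_sub_left (1:ℝ)).continuousAt hne hbdd
  rw [← h]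
  rfl

/-! ### The access segment and the exit ray are exchanged -/

/-- **The primed access segment is the unprimed exit ray.** -/
theorem rev_access (hφ : D.IsChordalUniformizing φ) (hφ' : D.swap.IsChordalUniformizing φ')
    (hc : 0 < c) (heq : ∀ z ∈ upperHalfPlaneSet, φ' z = φ (-((c : ℂ) * z)⁻¹)) (he : 0 < e)
    (he' : e ≤ 1 / 2) (hU : Continuous U) (hcl : ∀ s, U s ∈ closure D.carrier) (h1a : U 1 ≠ D.pt 0)
    (hij : lastA (D.pt 0) U ≤ firstB (D.pt 1) U) :
    (fun s : ℝ => φ'.boundaryExtension ((s : ℂ) * pAcc (D.pt 1) φ'.boundaryExtension e (fun u => U (1 - u)))) ''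
        Ioc 0 (sAcc (D.pt 1) (D.pt 0) φ'.boundaryExtension e (fun u => U (1 - u))) =
      (fun r : ℝ => φ.boundaryExtension ((r : ℂ) * qEx (D.pt 1) φ.boundaryExtension e U)) ''
        {r | rEx (D.pt 0) (D.pt 1) φ.boundaryExtension e U ≤ r ∧ U (firstB (D.pt 1) U) ≠ D.pt 1} := by
  by_cases hjb : U (firstB (D.pt 1) U) = D.pt 1
  · obtain ⟨-, hs', -, -⟩ := rev_of_lastB hφ hφ' hc heq he he' hcl hij hjb
    have h2 : {r : ℝ | rEx (D.pt 0) (D.pt 1) φ.boundaryExtension e U ≤ r ∧ U (firstB (D.pt 1) U) ≠ D.pt 1} = ∅ := by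
      ext r; simp only [mem_setOf_eq, mem_empty_iff_false, iff_false, not_and]
      exact fun _ h => h hjb
    rw [hs', Ioc_self, h2, image_empty, image_empty]
  obtain ⟨hp', hs', -⟩ := rev_sAcc_of_ne hφ hφ' hc heq he he' hU hcl h1a hij hjb
  obtain ⟨hr1, -, -, hq⟩ := exit_spec hφ he he' hU hcl h1a hij hjb
  have hr0 : 0 < rEx (D.pt 0) (D.pt 1) φ.boundaryExtension e U := zero_lt_one.trans_le hr1
  have hray : ∀ {s : ℝ}, 0 < s →
      φ'.boundaryExtension ((s : ℂ) * -((c : ℂ) * qEx (D.pt 1) φ.boundaryExtension e U)⁻¹) =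
        φ.boundaryExtension (((s⁻¹ : ℝ) : ℂ) * qEx (D.pt 1) φ.boundaryExtension e U) :=
    fun hs => bExt_swap_ray hc heq hq hs
  rw [hs', hp']
  ext w
  simp only [mem_image, mem_Ioc, mem_setOf_eq]
  constructor
  · rintro ⟨s, ⟨hs0, hs1⟩, rfl⟩
    exact ⟨s⁻¹, ⟨(le_inv_comm₀ hs0 hr0).1 hs1, hjb⟩, (hray hs0).symm⟩
  · rintro ⟨ρ, ⟨hρ, -⟩, rfl⟩
    have hρ0 : 0 < ρ := hr0.trans_le hρ
    refine ⟨ρ⁻¹, ⟨inv_pos.2 hρ0, inv_anti₀ hr0 hρ⟩, ?_⟩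
    rw [hray (inv_pos.2 hρ0), inv_inv]

/-- **The primed exit ray is the unprimed access segment.** -/
theorem rev_exit (hφ : D.IsChordalUniformizing φ) (hφ' : D.swap.IsChordalUniformizing φ')
    (hc : 0 < c) (heq : ∀ z ∈ upperHalfPlaneSet, φ' z = φ (-((c : ℂ) * z)⁻¹)) (he : 0 < e)
    (he' : e ≤ 1 / 2) (hU : Continuous U) (hcl : ∀ s, U s ∈ closure D.carrier) (h0b : U 0 ≠ D.pt 1)
    (hij : lastA (D.pt 0) U ≤ firstB (D.pt 1) U) :
    (fun r : ℝ => φ'.boundaryExtension ((r : ℂ) * qEx (D.pt 0) φ'.boundaryExtension e (fun u => U (1 - u)))) ''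
        {r | rEx (D.pt 1) (D.pt 0) φ'.boundaryExtension e (fun u => U (1 - u)) ≤ r ∧
          (fun u => U (1 - u)) (firstB (D.pt 0) fun u => U (1 - u)) ≠ D.pt 0} =
      (fun s : ℝ => φ.boundaryExtension ((s : ℂ) * pAcc (D.pt 0) φ.boundaryExtension e U)) ''
        Ioc 0 (sAcc (D.pt 0) (D.pt 1) φ.boundaryExtension e U) := by
  have hguard_eq : U (1 - firstB (D.pt 0) fun u => U (1 - u)) = U (lastA (D.pt 0) U) :=
    rev_guard U
  by_cases hia : U (lastA (D.pt 0) U) = D.pt 0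
  · obtain ⟨-, hs, -, -⟩ := rev_of_firstA hφ φ' he he' hcl hij hia
    have h1 : {r : ℝ | rEx (D.pt 1) (D.pt 0) φ'.boundaryExtension e (fun u => U (1 - u)) ≤ r ∧
        (fun u => U (1 - u)) (firstB (D.pt 0) fun u => U (1 - u)) ≠ D.pt 0} = ∅ := by
      ext r; simp only [mem_setOf_eq, mem_empty_iff_false, iff_false, not_and]
      intro _ h; rw [hguard_eq] at h; exact h hia
    rw [hs, Ioc_self, h1, image_empty, image_empty]
  obtain ⟨hq', hr', -⟩ := rev_rEx_of_ne hφ hφ' hc heq he he' hU hcl h0b hij hia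
  obtain ⟨hs01, -, -, hp⟩ := access_spec hφ he he' hU hcl h0b hij hia
  have hray : ∀ {ρ : ℝ}, 0 < ρ →
      φ'.boundaryExtension ((ρ : ℂ) * -((c : ℂ) * pAcc (D.pt 0) φ.boundaryExtension e U)⁻¹) =
        φ.boundaryExtension (((ρ⁻¹ : ℝ) : ℂ) * pAcc (D.pt 0) φ.boundaryExtension e U) :=
    fun hρ => bExt_swap_ray hc heq hp hρ
  have hguard : U (1 - firstB (D.pt 0) fun u => U (1 - u)) ≠ D.pt 0 := by
    rw [hguard_eq]; exact hia
  rw [hr', hq']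
  ext w
  simp only [mem_image, mem_Ioc, mem_setOf_eq]
  constructor
  · rintro ⟨ρ, ⟨hρ, -⟩, rfl⟩
    have hρ0 : 0 < ρ := (inv_pos.2 hs01.1).trans_le hρ
    exact ⟨ρ⁻¹, ⟨inv_pos.2 hρ0, inv_le_of_inv_le₀ hs01.1 hρ⟩, (hray hρ0).symm⟩
  · rintro ⟨σ, ⟨hσ0, hσs⟩, rfl⟩
    refine ⟨σ⁻¹, ⟨inv_anti₀ hσ0 hσs, ?_⟩, ?_⟩
    · simpa only using hguard
    · rw [hray (inv_pos.2 hσ0), inv_inv]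

/-! ### The traces -/

/-- **The prescribed traces coincide: `S₁' = S₁`** (trimmed interval nonempty). -/
theorem rev_attSet (hφ : D.IsChordalUniformizing φ) (hφ' : D.swap.IsChordalUniformizing φ')
    (hc : 0 < c) (heq : ∀ z ∈ upperHalfPlaneSet, φ' z = φ (-((c : ℂ) * z)⁻¹)) (he : 0 < e)
    (he' : e ≤ 1 / 2) (hU : Continuous U) (hcl : ∀ s, U s ∈ closure D.carrier) (h0b : U 0 ≠ D.pt 1)
    (h1a : U 1 ≠ D.pt 0) (hij : lastA (D.pt 0) U ≤ firstB (D.pt 1) U) :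
    attSet (D.pt 1) (D.pt 0) φ'.boundaryExtension e (fun u => U (1 - u)) =
      attSet (D.pt 0) (D.pt 1) φ.boundaryExtension e U := by
  have hA := rev_access hφ hφ' hc heq he he' hU hcl h1a hij
  have hE := rev_exit hφ hφ' hc heq he he' hU hcl h0b hij
  have hu' := rev_uMid hφ hφ' hc heq he he' hU hcl h1a hij
  have hv' := rev_vMid hφ hφ' hc heq he he' hU hcl h0b hij
  have hZfun : attZ (D.pt 0) φ'.boundaryExtension e (fun u => U (1 - u)) =
      attZ (D.pt 1) φ.boundaryExtension e U ∘ fun t : ℝ => 1 - t :=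
    funext fun u => rev_attZ hφ hφ' hc heq he he' hcl u
  unfold attSet
  rw [hA, hE, hu', hv', hZfun, image_comp, image_const_sub_Icc, sub_sub_cancel, sub_sub_cancel,
    Set.pair_comm (D.pt 1) (D.pt 0)]
  ext w
  simp only [mem_union]
  tauto

/-- **An empty trimmed interval gives `uMid = vMid = 0`.** -/
theorem uMid_vMid_of_lt {x y : ℂ} {Φ : ℂ → ℂ} {e : ℝ} {R : ℝ → ℂ} (h : firstB y R < lastA x R) :
    uMid x y Φ e R = 0 ∧ vMid x y Φ e R = 0 := by
  have hI : ∀ u, u ∉ Icc (lastA x R) (firstB y R) := fun u hu => (not_le.2 h) (hu.1.trans hu.2)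
  constructor
  · unfold uMid
    convert Real.sInf_empty
    ext u; simp only [mem_setOf_eq, mem_empty_iff_false, iff_false, not_and]
    exact fun hu _ => hI u hu
  · unfold vMid
    convert Real.sSup_empty
    ext u
    simp only [mem_union, mem_setOf_eq, mem_empty_iff_false, iff_false, not_or, not_and]
    exact ⟨fun hu _ => (hI u hu).elim, fun hu _ => (hI u hu).elim⟩

/-- **The fallback traces coincide**: `{b, a} ∪ Φ'(iℝ₊) = {a, b} ∪ Φ(iℝ₊)` (the inversion maps the
imaginary axis onto itself). -/
theorem rev_fallback (hc : 0 < c) (heq : ∀ z ∈ upperHalfPlaneSet, φ' z = φ (-((c : ℂ) * z)⁻¹)) :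
    fallback (D.pt 1) (D.pt 0) φ'.boundaryExtension = fallback (D.pt 0) (D.pt 1) φ.boundaryExtension := by
  have hkey : ∀ y : ℝ, 0 < y → φ'.boundaryExtension (I * (y : ℂ)) =
      φ.boundaryExtension (I * (((c * y)⁻¹ : ℝ) : ℂ)) := by
    intro y hy
    have him : 0 < (I * (y : ℂ)).im := by simp [hy]
    have hne : I * (y : ℂ) ≠ 0 := by intro h; rw [h] at him; simp at him
    rw [bExt_swap_eq hc heq him.le hne]
    congr 1
    have hc' : (c : ℂ) ≠ 0 := Complex.ofReal_ne_zero.2 hc.ne'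
    have hy' : (y : ℂ) ≠ 0 := Complex.ofReal_ne_zero.2 hy.ne'
    rw [mul_inv, mul_inv, Complex.inv_I]
    push_cast
    rw [mul_inv]
    ring
  unfold fallback
  rw [Set.pair_comm (D.pt 1) (D.pt 0)]
  congr 1
  ext w
  simp only [mem_image, mem_Ioi]
  constructor
  · rintro ⟨y, hy, rfl⟩
    exact ⟨(c * y)⁻¹, by positivity, (hkey y hy).symm⟩
  · rintro ⟨y, hy, rfl⟩
    refine ⟨(c * y)⁻¹, by positivity, ?_⟩
    rw [hkey _ (by positivity)]
    congr 3
    field_simp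

/-! ### The main symmetry -/

/-- **Exact reversal symmetry of the attachment data.** For the unprimed data `(a, b, Φ, e, U)` and
the primed data `(b, a, Φ', e, U')`, `U' u = U (1 - u)`: the cut-time conditions agree, the prescribed
traces agree when the condition holds, and the fallback traces agree. -/
theorem rev_main (hφ : D.IsChordalUniformizing φ) (hφ' : D.swap.IsChordalUniformizing φ')
    (hc : 0 < c) (heq : ∀ z ∈ upperHalfPlaneSet, φ' z = φ (-((c : ℂ) * z)⁻¹)) (he : 0 < e)
    (he' : e ≤ 1 / 2) (hU : Continuous U) (hcl : ∀ s, U s ∈ closure D.carrier) (h0b : U 0 ≠ D.pt 1)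
    (h1a : U 1 ≠ D.pt 0) :
    (uMid (D.pt 1) (D.pt 0) φ'.boundaryExtension e (fun u => U (1 - u)) <
        vMid (D.pt 1) (D.pt 0) φ'.boundaryExtension e (fun u => U (1 - u)) ↔
      uMid (D.pt 0) (D.pt 1) φ.boundaryExtension e U < vMid (D.pt 0) (D.pt 1) φ.boundaryExtension e U) ∧
    (uMid (D.pt 0) (D.pt 1) φ.boundaryExtension e U < vMid (D.pt 0) (D.pt 1) φ.boundaryExtension e U →
      attSet (D.pt 1) (D.pt 0) φ'.boundaryExtension e (fun u => U (1 - u)) =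
        attSet (D.pt 0) (D.pt 1) φ.boundaryExtension e U) ∧
    fallback (D.pt 1) (D.pt 0) φ'.boundaryExtension = fallback (D.pt 0) (D.pt 1) φ.boundaryExtension := by
  refine ⟨?_, fun hlt => ?_, rev_fallback hc heq⟩
  · by_cases hij : lastA (D.pt 0) U ≤ firstB (D.pt 1) U
    · rw [rev_uMid hφ hφ' hc heq he he' hU hcl h1a hij, rev_vMid hφ hφ' hc heq he he' hU hcl h0b hij]
      constructor <;> intro h <;> linarith
    · have h1 := uMid_vMid_of_lt (Φ := φ.boundaryExtension) (e := e) (not_le.1 hij)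
      have hij' : ¬ lastA (D.pt 1) (fun u => U (1 - u)) ≤ firstB (D.pt 0) (fun u => U (1 - u)) := by
        rwa [rev_le_iff]
      have h2 := uMid_vMid_of_lt (Φ := φ'.boundaryExtension) (e := e) (not_le.1 hij')
      rw [h1.1, h1.2, h2.1, h2.2]
  · have hij : lastA (D.pt 0) U ≤ firstB (D.pt 1) U := by
      by_contra h
      have h1 := uMid_vMid_of_lt (Φ := φ.boundaryExtension) (e := e) (not_le.1 h)
      rw [h1.1, h1.2] at hlt
      exact lt_irrefl _ hlt
    exact rev_attSet hφ hφ' hc heq he he' hU hcl h0b h1a hij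

end Summit.CriticalPhenomena.SAWScalingLimit.Theorems.AttachReversal

end
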